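import Summits.CriticalPhenomena.PercolationContinuityZ3.Theorems.PercNearOneGluingNoHeavyLowerTailKnQuestion8AntitheticWedgeTransfer
import Summits.CriticalPhenomena.PercolationContinuityZ3.Theorems.PercNearOneGluingNoHeavyLowerTailKnQuestion8AntitheticWedgePoset
import HarnessLib

/-!
# `NoHeavyLowerTail` (crux stmt-CriticalPhenomena-4575), antithetic vdBHK programme: the wedge gluing `T(X;L)` is antipodal Kleitman AS AN ORDERED SET
# — the intrinsic form of `wedge_transfer`

Support file (seat `prim-ineq-gen-7` gen 51; `--supports stmt-CriticalPhenomena-4575`).  No `sorry`, no definitions.  Memo: FINDING-FENCE-g51.md §6.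

`AntitheticWedgeTransfer.wedge_transfer` proves the AK inequality of `T(X;L)` for QUADRUPLES of up-sets of `X`; `AntitheticWedgePoset.upset_iff` says that
these quadruples are exactly the sheets of the subsets of `X × Fin 4` that are up-closed for the wedge-gluing relation.  This file assembles the two
into the statement one actually iterates along a fence: for ALL finite `U, V ⊆ X × Fin 4` up-closed for the wedge-gluing relation,
`#(U ∩ ι_T V) ≤ #(U ∩ V)`, where `ι_T (x,i) = (ι x, s i)` and `s` swaps the sheets `0 ↔ 3`, `1 ↔ 2` (given by its four values, no arithmetic).
* `mem_sheet`, `card_eq_sum_sheets`, `sheet_inter`, `mem_sheet_image` — sheets `U_i = {x : (x,i) ∈ U}` and how `∩`, `#`, `ι_T` act on them.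
* `wedge_ak` — **AK of the ordered set `T(X;L)`** from AK(X) (up-set form, any self-map `ι`), `L` a down-set, and (R) for `(X,L)` (quadruple form).
With the machine-certified instances of (R) (all rooted posets ≤ 4 elements; the W-fence at its end atoms, kit j284847) this is the formal statement
'`Ω_{Q ∪_a wedge}` is AK', e.g. for the 7-element fence.
-/

namespace Summit.CriticalPhenomena.PercolationContinuityZ3.Theorems

open Finset

namespace AntitheticWedgeIntrinsic

variable {X : Type*} [PartialOrder X] [DecidableEq X]

omit [PartialOrder X] in
/-- Membership in the sheet `U_i = {x : (x,i) ∈ U}`. -/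
theorem mem_sheet (U : Finset (X × Fin 4)) (i : Fin 4) (x : X) :
    x ∈ (U.filter (fun p => p.2 = i)).image Prod.fst ↔ (x, i) ∈ U := by
  simp only [Finset.mem_image, Finset.mem_filter]
  constructor
  · rintro ⟨⟨x', i'⟩, ⟨hU, hi⟩, hx⟩
    simp only at hx hi
    subst hx; subst hi; exact hU
  · intro h
    exact ⟨(x, i), ⟨h, rfl⟩, rfl⟩

omit [PartialOrder X] in
/-- A finite subset of `X × Fin 4` is counted by its four sheets. -/
theorem card_eq_sum_sheets (U : Finset (X × Fin 4)) :
    U.card = ∑ i : Fin 4, ((U.filter (fun p => p.2 = i)).image Prod.fst).card := by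
  rw [Finset.card_eq_sum_card_fiberwise (f := Prod.snd) (s := U) (t := (Finset.univ : Finset (Fin 4)))
    (fun p _ => Finset.mem_coe.2 (Finset.mem_univ _))]
  refine Finset.sum_congr rfl fun i _ => ?_
  rw [Finset.card_image_of_injOn]
  intro p hp q hq h
  have hp' := (Finset.mem_filter.1 (Finset.mem_coe.1 hp)).2
  have hq' := (Finset.mem_filter.1 (Finset.mem_coe.1 hq)).2
  exact Prod.ext h (hp'.trans hq'.symm)

omit [PartialOrder X] in
/-- Sheets commute with intersection. -/
theorem sheet_inter (U V : Finset (X × Fin 4)) (i : Fin 4) :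
    ((U ∩ V).filter (fun p => p.2 = i)).image Prod.fst =
      (U.filter (fun p => p.2 = i)).image Prod.fst ∩ (V.filter (fun p => p.2 = i)).image Prod.fst := by
  ext x
  rw [mem_sheet, Finset.mem_inter, Finset.mem_inter, mem_sheet, mem_sheet]

omit [PartialOrder X] in
/-- The sheet `i` of `ι_T V` is `ι` of the sheet `s i` of `V` (for any self-map `ι` and an involutive sheet swap `s`). -/
theorem mem_sheet_image (ι : X → X) (s : Fin 4 → Fin 4) (hss : ∀ i, s (s i) = i)
    (V : Finset (X × Fin 4)) (i : Fin 4) (x : X) :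
    x ∈ ((V.image (fun p => (ι p.1, s p.2))).filter (fun p => p.2 = i)).image Prod.fst ↔
      x ∈ ((V.filter (fun p => p.2 = s i)).image Prod.fst).image ι := by
  rw [mem_sheet, Finset.mem_image, Finset.mem_image]
  constructor
  · rintro ⟨⟨x', i'⟩, hV, hxi⟩
    simp only [Prod.mk.injEq] at hxi
    obtain ⟨hx, hi⟩ := hxi
    refine ⟨x', ?_, hx⟩
    rw [mem_sheet]
    have : s i = i' := by rw [← hi, hss i']
    rw [this]; exact hV
  · rintro ⟨x', hx', hx⟩
    rw [mem_sheet] at hx'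
    exact ⟨(x', s i), hx', by simp [hx, hss i]⟩

/-- **AK OF THE WEDGE GLUING, INTRINSIC FORM.**  `X` AK in up-set form w.r.t. a self-map `ι`, `L` a down-set, (R) for `(X,L)` in quadruple form, `s` the
sheet swap `0↔3, 1↔2`.  Then for all finite `U, V ⊆ X × Fin 4` that are up-closed for the wedge-gluing relation of `AntitheticWedgePoset`:
`#(U ∩ ι_T V) ≤ #(U ∩ V)` with `ι_T (x,i) = (ι x, s i)` — the ordered set `T(X;L)` is antipodal Kleitman. [this work] -/
theorem wedge_ak (ι : X → X)
    (hAK : ∀ V Y : Finset X, (∀ x y, x ≤ y → x ∈ V → y ∈ V) → (∀ x y, x ≤ y → x ∈ Y → y ∈ Y) →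
      (V ∩ Y.image ι).card ≤ (V ∩ Y).card)
    (L : Finset X) (hLdown : ∀ x y : X, x ≤ y → y ∈ L → x ∈ L)
    (hR : ∀ A₁ A₂ A₃ A₄ B₁ B₂ B₃ B₄ : Finset X,
      (∀ x y, x ≤ y → x ∈ A₁ → y ∈ A₁) → (∀ x y, x ≤ y → x ∈ A₂ → y ∈ A₂) →
      (∀ x y, x ≤ y → x ∈ A₃ → y ∈ A₃) → (∀ x y, x ≤ y → x ∈ A₄ → y ∈ A₄) →
      (∀ x y, x ≤ y → x ∈ B₁ → y ∈ B₁) → (∀ x y, x ≤ y → x ∈ B₂ → y ∈ B₂) →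
      (∀ x y, x ≤ y → x ∈ B₃ → y ∈ B₃) → (∀ x y, x ≤ y → x ∈ B₄ → y ∈ B₄) →
      A₁ ⊆ A₃ → A₂ ⊆ A₄ → (∀ x, x ∈ L → x ∈ A₃ → x ∈ A₄) → (∀ x, x ∉ L → x ∈ A₁ → x ∈ A₂) →
      (∀ x y, x ≤ y → x ∈ L → y ∉ L → x ∈ A₃ → y ∈ A₄) → (∀ x y, x ≤ y → x ∈ L → y ∉ L → x ∈ A₂ → y ∈ A₃) →
      B₁ ⊆ B₃ → B₂ ⊆ B₄ → (∀ x, x ∈ L → x ∈ B₃ → x ∈ B₄) → (∀ x, x ∉ L → x ∈ B₁ → x ∈ B₂) →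
      (∀ x y, x ≤ y → x ∈ L → y ∉ L → x ∈ B₃ → y ∈ B₄) → (∀ x y, x ≤ y → x ∈ L → y ∉ L → x ∈ B₂ → y ∈ B₃) →
      (A₂ ∩ B₃.image ι).card + (A₃ ∩ B₂.image ι).card ≤
        (A₂ ∩ B₂).card + (A₃ ∩ B₃).card + ((A₄ \ A₁) ∩ (B₄ \ B₁)).card)
    (s : Fin 4 → Fin 4) (hs0 : s 0 = 3) (hs1 : s 1 = 2) (hs2 : s 2 = 1) (hs3 : s 3 = 0)
    (U V : Finset (X × Fin 4))
    (hU : ∀ p q : X × Fin 4,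
        (p.1 ≤ q.1 ∧ (p.2 = q.2 ∨ (p.2 = 0 ∧ q.2 = 2) ∨ (p.2 = 1 ∧ q.2 = 3) ∨ (p.2 = 0 ∧ q.2 = 3) ∨ (p.2 = 2 ∧ q.2 = 3 ∧ p.1 ∈ L) ∨
        (p.2 = 0 ∧ q.2 = 1 ∧ q.1 ∉ L) ∨ (p.2 = 1 ∧ q.2 = 2 ∧ p.1 ∈ L ∧ q.1 ∉ L))) →
        p ∈ U → q ∈ U)
    (hV : ∀ p q : X × Fin 4,
        (p.1 ≤ q.1 ∧ (p.2 = q.2 ∨ (p.2 = 0 ∧ q.2 = 2) ∨ (p.2 = 1 ∧ q.2 = 3) ∨ (p.2 = 0 ∧ q.2 = 3) ∨ (p.2 = 2 ∧ q.2 = 3 ∧ p.1 ∈ L) ∨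
        (p.2 = 0 ∧ q.2 = 1 ∧ q.1 ∉ L) ∨ (p.2 = 1 ∧ q.2 = 2 ∧ p.1 ∈ L ∧ q.1 ∉ L))) →
        p ∈ V → q ∈ V) :
    (U ∩ V.image (fun p => (ι p.1, s p.2))).card ≤ (U ∩ V).card := by
  classical
  have hss : ∀ i, s (s i) = i := by
    intro i
    fin_cases i <;> simp [hs0, hs1, hs2, hs3]
  -- the sheets
  set U0 := (U.filter (fun p => p.2 = 0)).image Prod.fst with hU0
  set U1 := (U.filter (fun p => p.2 = 1)).image Prod.fst with hU1
  set U2 := (U.filter (fun p => p.2 = 2)).image Prod.fst with hU2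
  set U3 := (U.filter (fun p => p.2 = 3)).image Prod.fst with hU3
  set V0 := (V.filter (fun p => p.2 = 0)).image Prod.fst with hV0
  set V1 := (V.filter (fun p => p.2 = 1)).image Prod.fst with hV1
  set V2 := (V.filter (fun p => p.2 = 2)).image Prod.fst with hV2
  set V3 := (V.filter (fun p => p.2 = 3)).image Prod.fst with hV3
  -- the patterns (from the dictionary)
  obtain ⟨uup, u02, u13, u23, u01, uC23, uC12⟩ := (AntitheticWedgePoset.upset_iff L hLdown U).1 hU
  obtain ⟨vup, v02, v13, v23, v01, vC23, vC12⟩ := (AntitheticWedgePoset.upset_iff L hLdown V).1 hV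
  have upsh : ∀ (W : Finset (X × Fin 4)), (∀ i : Fin 4, ∀ a b : X, a ≤ b → (a, i) ∈ W → (b, i) ∈ W) →
      ∀ i : Fin 4, ∀ a b : X, a ≤ b → a ∈ (W.filter (fun p => p.2 = i)).image Prod.fst → b ∈ (W.filter (fun p => p.2 = i)).image Prod.fst := by
    intro W hW i a b hab ha
    rw [mem_sheet] at ha ⊢
    exact hW i a b hab ha
  have wt := AntitheticWedgeTransfer.wedge_transfer ι hAK L hR U0 U1 U2 U3 V0 V1 V2 V3 (upsh U uup 0) (upsh U uup 1) (upsh U uup 2)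
    (upsh U uup 3) (upsh V vup 0) (upsh V vup 1) (upsh V vup 2) (upsh V vup 3)
    (fun x hx => by rw [hU0, mem_sheet] at hx; rw [hU2, mem_sheet]; exact u02 x hx)
    (fun x hx => by rw [hU1, mem_sheet] at hx; rw [hU3, mem_sheet]; exact u13 x hx)
    (fun x hL hx => by rw [hU2, mem_sheet] at hx; rw [hU3, mem_sheet]; exact u23 x hL hx)
    (fun x hL hx => by rw [hU0, mem_sheet] at hx; rw [hU1, mem_sheet]; exact u01 x hL hx)
    (fun x y hxy hxL hyL hx => by rw [hU2, mem_sheet] at hx; rw [hU3, mem_sheet]; exact uC23 x y hxy hxL hyL hx)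
    (fun x y hxy hxL hyL hx => by rw [hU1, mem_sheet] at hx; rw [hU2, mem_sheet]; exact uC12 x y hxy hxL hyL hx)
    (fun x hx => by rw [hV0, mem_sheet] at hx; rw [hV2, mem_sheet]; exact v02 x hx)
    (fun x hx => by rw [hV1, mem_sheet] at hx; rw [hV3, mem_sheet]; exact v13 x hx)
    (fun x hL hx => by rw [hV2, mem_sheet] at hx; rw [hV3, mem_sheet]; exact v23 x hL hx)
    (fun x hL hx => by rw [hV0, mem_sheet] at hx; rw [hV1, mem_sheet]; exact v01 x hL hx)
    (fun x y hxy hxL hyL hx => by rw [hV2, mem_sheet] at hx; rw [hV3, mem_sheet]; exact vC23 x y hxy hxL hyL hx)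
    (fun x y hxy hxL hyL hx => by rw [hV1, mem_sheet] at hx; rw [hV2, mem_sheet]; exact vC12 x y hxy hxL hyL hx)
  -- cards as sums over the four sheets
  have eR : (U ∩ V).card = (U0 ∩ V0).card + (U1 ∩ V1).card + (U2 ∩ V2).card + (U3 ∩ V3).card := by
    rw [card_eq_sum_sheets, Fin.sum_univ_four, sheet_inter, sheet_inter, sheet_inter, sheet_inter]
  have eSheet : ∀ i : Fin 4, (((U ∩ V.image (fun p => (ι p.1, s p.2))).filter (fun p => p.2 = i)).image Prod.fst) =
      (U.filter (fun p => p.2 = i)).image Prod.fst ∩ ((V.filter (fun p => p.2 = s i)).image Prod.fst).image ι := by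
    intro i
    ext x
    rw [sheet_inter, Finset.mem_inter, Finset.mem_inter, mem_sheet_image ι s hss]
  have eL : (U ∩ V.image (fun p => (ι p.1, s p.2))).card =
      (U0 ∩ V3.image ι).card + (U1 ∩ V2.image ι).card + (U2 ∩ V1.image ι).card + (U3 ∩ V0.image ι).card := by
    rw [card_eq_sum_sheets, Fin.sum_univ_four, eSheet, eSheet, eSheet, eSheet, hs0, hs1, hs2, hs3]
  rw [eL, eR]
  linarith [wt]

end AntitheticWedgeIntrinsic

end Summit.CriticalPhenomena.PercolationContinuityZ3.Theorems
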